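import Literature.NumberTheory.EllipticCurves.Sprung2017.SharpFlatPAdicLFunction
import Literature.NumberTheory.EllipticCurves.PAdicLFunctionMinusIntegralityProofs
import Literature.NumberTheory.EllipticCurves.PAdicLFunctionIntegralityAtTwoProofs
import HarnessLib

/-!
# The odd-branch Mazur–Tate element `θ_n(ω^{#Δ/2}, T)` on MINUS modular symbols and its ♯/♭ pairs
# (carrier; at `p = 2`: the `ω = χ₋₄` branch of level `2^{n+2}`)

Topic `NumberTheory/EllipticCurves`; namespaces `Literature.NumberTheory.EllipticCurves` (the element)
and `Literature.NumberTheory.EllipticCurves.Sprung2017` (the pair predicate). DEFINITIONS WITH BODIES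
and proved unfolding lemmas only: no theorem of the literature is asserted, no named fact (D-0014,
D-0026). Requested by cell `bsd-f1-sign2` (planner asks D-ty-2 of MEMO-an §5 and D1 (minimal form) of
MEMO-desc §7: "the `ω¹`-branch Mazur–Tate element at `2` for supersingular curves; the IMC sketch only
has the ordinary odd branch `padicLFunctionMinusBranch`").

## Mathematics

Let `f ∈ S₂(Γ₀(N))` and `p` a prime; `Δ ⊂ ℤ_p^×` the torsion subgroup (`#Δ = torsionOrder p`:
`p − 1` for odd `p`, `2` for `p = 2`), `γ = cyclotomicGenerator p` (`1 + p`, resp. `5`),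
`p^{n + e₀}` the level (`e₀ = cyclotomicExponent p`). For a tame character `ω^i` of `Δ`, Sprung
[Sprung2017, §1 p. 10] (after Mazur–Tate–Teitelbaum [MazurTateTeitelbaum1986Invent, §I.8, §I.13])
defines the Mazur–Tate element of the branch `ω^i`,
`θ_n(ω^i, T) = Σ_{a ∈ (ℤ/p^{n+e₀})ˣ} [a/p^{n+e₀}]_f^{sign(ω^i)} ω^i(a) (1+T)^{log_γ a}`,
built on the plus symbols for even `ω^i` and on the MINUS symbols `[r]⁻_f` (`ratMinusSymbol`,
period `Ω⁻_f`) for odd `ω^i`; "for a fixed tame character `ω^i` the `θ_n(ω^i,T)` form a queue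
sequence" (loc. cit.), and Thm. 1.12 / Cor. 4.4 ("Fix a tame character `ω^i`") give the ♯/♭ pair of
every branch by the SAME matrices `𝒞_1 ⋯ 𝒞_n` as for the trivial character.

This file types the branch of the QUADRATIC character `ω^{#Δ/2}` (`u ↦ u^{#Δ/2} ∈ {±1}`,
`torsionQuadChar`), on minus symbols:
`mazurTateElementOdd f p n = Σ_{η ∈ Δ} Σ_{s mod pⁿ} ω^{#Δ/2}(η)·[η γ^s / p^{n+e₀}]⁻_f (1+T)^s ∈ ℚ[T]`.
It IS Sprung's `θ_n(ω^{#Δ/2}, T)` exactly when `ω^{#Δ/2}` is odd, i.e. for `p = 2` (`Δ = {±1}`,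
`ω^{#Δ/2} = ω = χ₋₄`: THE odd branch at `2`, level `2^{n+2}`) and for `p ≡ 3 (mod 4)` (at `p = 3`:
`ω = χ₋₃`, the Summit-side twin `O5GrowthLaws.mazurTateElementOddThree` is the same polynomial); for
`p ≡ 1 (mod 4)` the character `ω^{(p−1)/2}` is even and this minus-symbol sum is not a branch
(`-- TODO(general form)`: the `ω^i`-branches for `ω^i` non-quadratic have `ℤ_p`-valued, not rational,
weights; not requested).

At `p = 2` the two elements of `Δ = {±1}` give the same summand (`[−r]⁻ = −[r]⁻`,
`ratMinusSymbol_neg`, cancels `ω(−1) = −1`): `θ⁻_n(T) = Σ_{s mod 2ⁿ} 2·[5^s/2^{n+2}]⁻_f (1+T)^s`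
(`mazurTateElementOdd_two_eq`, twin of `Sprung2017.mazurTateElement_two_eq`); at level `0`,
`θ⁻_0 = 2·[1/4]⁻_f = [1/4]⁻_f − [3/4]⁻_f` (`mazurTateElementOdd_two_zero`,
`eval_zero_mazurTateElementOdd_two_zero`) — the quantity of
`constantCoeff_padicLFunctionMinusBranch_one_two` (`= α²·L⁻₂(f,α,ω,0)` there) and, by Birch's lemma
(`ratMinusTwistedSymbolSum_mul_minusPeriod_mul_I`, `τ(χ₋₄) = 2i`), `2·L(f, χ₋₄, 1)/Ω⁻_f` up to the
tree's normalisation of `Ω⁻_f` (that identification is not made here).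

`Sprung2017.IsSprungPairOdd f p ap L♯₋ L♭₋`: the ♯/♭ pair predicate of this branch — verbatim the
tree's `Sprung2017.IsSprungPair` with `mazurTateElement` replaced by `mazurTateElementOdd` and the SAME
polynomials `u_n = sharpPoly ap p n`, `v_n = flatPoly ap p n` (Sprung 2017 Thm. 1.12 / Cor. 4.4 for the
tame character `ω^{#Δ/2}`; a predicate, nothing asserted; existence for rational newforms at `2` is
NOT proved here — the even-branch existence is the tree's `Sprung2017.exists_isSprungPair_two`).

References: [Sprung2017] F. Sprung, *On pairs of p-adic L-functions for weight-two modular forms*,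
Algebra & Number Theory 11 (2017), §1 (p. 10: `θ_n(ω^i,T)`), Thm. 1.12, Cor. 4.4
[corpus: paper:arxiv-1601.00010 p0010 L21–L27, L63]; [MazurTateTeitelbaum1986Invent] B. Mazur,
J. Tate, J. Teitelbaum, Invent. Math. 84 (1986), §I.8 (the symbols `[a/m]^±`), §I.13 (`p = 2`:
`Δ = {±1}`, `γ = 5`); [Pollack2003] R. Pollack, Duke Math. J. 118 (2003), Def. 6.15.
-/

noncomputable section

open scoped MatrixGroups ModularForm

open scoped Classical

open CongruenceSubgroup Polynomial Literature.NumberTheory.EllipticCurves.ModularForms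

namespace Literature.NumberTheory.EllipticCurves

/-! ### The quadratic character of the torsion `Δ ⊂ ℤ_pˣ` -/

section QuadChar

variable (p : ℕ) [Fact p.Prime]

/-- **The quadratic character `ω^{#Δ/2}` of the torsion subgroup `Δ ⊂ ℤ_pˣ`**, read on Teichmüller
representatives `u ∈ ℤ_p` and valued in `{±1} ⊂ ℤ`: `u ↦ 1` if `u^{#Δ/2} = 1`, else `−1`
(`#Δ = torsionOrder p`). On `Δ`: `ω^{#Δ/2}(η) = η^{#Δ/2} = ±1`; at `p = 2` (`Δ = {±1}`) and `p = 3`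
it is `ω` itself (`χ₋₄`, resp. `χ₋₃`, on `Δ`); off `Δ` the value is junk. [cite: Sprung2017, §1 (p. 10, tame characters ω^i of Δ)] -/
def torsionQuadChar (u : ℤ_[p]) : ℤ :=
  if u ^ (torsionOrder p / 2) = 1 then 1 else -1

/-- `ω^{#Δ/2}(1) = 1`. [cite: Sprung2017, §1 (p. 10)] -/
@[simp] theorem torsionQuadChar_one : torsionQuadChar p 1 = 1 := by
  simp [torsionQuadChar]

/-- `ω^{#Δ/2}(u) ∈ {1, −1}`. [cite: Sprung2017, §1 (p. 10)] -/
theorem torsionQuadChar_eq_one_or (u : ℤ_[p]) :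
    torsionQuadChar p u = 1 ∨ torsionQuadChar p u = -1 := by
  unfold torsionQuadChar
  split_ifs <;> simp

/-- At `p = 2`: `ω(−1) = −1` (`Δ = {±1}`, `#Δ/2 = 1`). [cite: MazurTateTeitelbaum1986Invent, §I.13 (p = 2, Δ = {±1})] -/
@[simp] theorem torsionQuadChar_two_neg_one : torsionQuadChar 2 (-1) = -1 := by
  have h : ¬ ((-1 : ℤ_[2]) ^ (torsionOrder 2 / 2) = 1) := by
    rw [torsionOrder_two, show (2 / 2 : ℕ) = 1 from rfl, pow_one]
    intro h
    have h2 : (2 : ℤ_[2]) = 0 := by linear_combination -h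
    exact two_ne_zero h2
  simp [torsionQuadChar, h]

end QuadChar

/-! ### The odd-branch Mazur–Tate element -/

section OddElement

variable {N : ℕ} (f : CuspForm (Gamma0 N) 2) (p : ℕ) [Fact p.Prime]

/-- **The Mazur–Tate element of the quadratic branch on minus symbols**,
`θ⁻_n(f) = θ_n(ω^{#Δ/2}, T) = Σ_{η ∈ Δ} Σ_{s mod pⁿ} ω^{#Δ/2}(η)·[η γ^s / p^{n+e₀}]⁻_f · (1+T)^s ∈ ℚ[T]`
(`[r]⁻_f = ratMinusSymbol f r`, period `Ω⁻_f`; `Δ`, `γ`, `e₀` as in the tree's `mazurTateElement`,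
whose formula this is with `[·]⁺ ↦ ω^{#Δ/2}(η)·[·]⁻`). For `p = 2` this is the `ω = χ₋₄` branch
`θ_n(ω, T)` of level `2^{n+2}`, for `p ≡ 3 (mod 4)` the `ω^{(p−1)/2}` branch (Sprung's
`θ_n(ω^i,T) = Σ_a [a/p^N]^{sign ω^i} ω^i(a)(1+T)^{log_γ a}` with `ω^i` odd quadratic); for
`p ≡ 1 (mod 4)` (`ω^{(p−1)/2}` even) it is not a branch — see the module docstring.
[cite: Sprung2017, §1 (p. 10, θ_n(ω^i, T))] [cite: MazurTateTeitelbaum1986Invent, §I.8 and §I.13] -/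
def mazurTateElementOdd (n : ℕ) : ℚ[X] :=
  ∑ᶠ ξ : rootsOfUnity (torsionOrder p) ℤ_[p], ∑ s : ZMod (p ^ n),
    C ((torsionQuadChar p ((ξ : ℤ_[p]ˣ) : ℤ_[p]) : ℚ) * ratMinusSymbol f
        (((PadicInt.toZModPow (n + cyclotomicExponent p) ((ξ : ℤ_[p]ˣ) : ℤ_[p]) *
              (cyclotomicGenerator p : ZMod (p ^ (n + cyclotomicExponent p))) ^ s.val).val : ℚ) /
          (p : ℚ) ^ (n + cyclotomicExponent p))) *
      (X + 1) ^ s.val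

/-- Unfolding lemma. [cite: Sprung2017, §1 (p. 10)] -/
theorem mazurTateElementOdd_def (n : ℕ) :
    mazurTateElementOdd f p n =
      ∑ᶠ ξ : rootsOfUnity (torsionOrder p) ℤ_[p], ∑ s : ZMod (p ^ n),
        C ((torsionQuadChar p ((ξ : ℤ_[p]ˣ) : ℤ_[p]) : ℚ) * ratMinusSymbol f
            (((PadicInt.toZModPow (n + cyclotomicExponent p) ((ξ : ℤ_[p]ˣ) : ℤ_[p]) *
                  (cyclotomicGenerator p : ZMod (p ^ (n + cyclotomicExponent p))) ^ s.val).val : ℚ) /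
              (p : ℚ) ^ (n + cyclotomicExponent p))) *
          (X + 1) ^ s.val :=
  rfl

/-- **`θ⁻_n(0) = Σ_{η ∈ Δ} Σ_{s mod pⁿ} ω^{#Δ/2}(η)·[η γ^s/p^{n+e₀}]⁻_f`** — the value at the trivial
wild character (`(1+T)^s ↦ 1`); twin of the Summit-side `mazurTateElement_eval_zero`.
[cite: Sprung2017, §1 (p. 10)] -/
theorem eval_zero_mazurTateElementOdd [Fintype (rootsOfUnity (torsionOrder p) ℤ_[p])] (n : ℕ) :
    (mazurTateElementOdd f p n).eval 0 =
      ∑ ξ : rootsOfUnity (torsionOrder p) ℤ_[p], ∑ s : ZMod (p ^ n),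
        (torsionQuadChar p ((ξ : ℤ_[p]ˣ) : ℤ_[p]) : ℚ) * ratMinusSymbol f
          (((PadicInt.toZModPow (n + cyclotomicExponent p) ((ξ : ℤ_[p]ˣ) : ℤ_[p]) *
                (cyclotomicGenerator p : ZMod (p ^ (n + cyclotomicExponent p))) ^ s.val).val : ℚ) /
            (p : ℚ) ^ (n + cyclotomicExponent p)) := by
  rw [mazurTateElementOdd, finsum_eq_sum_of_fintype, eval_finsetSum]
  refine Finset.sum_congr rfl fun ξ _ ↦ ?_
  rw [eval_finsetSum]
  refine Finset.sum_congr rfl fun s _ ↦ ?_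
  simp

/-- The coefficient of `T^j` in `θ⁻_n`: `Σ_η Σ_s ω^{#Δ/2}(η)[η γ^s/p^{n+e₀}]⁻ · C(s, j)`
(binomial expansion of `(1+T)^s`); twin of `coeff_mazurTateElementK`. [cite: Sprung2017, §1 (p. 10)] -/
theorem coeff_mazurTateElementOdd [Fintype (rootsOfUnity (torsionOrder p) ℤ_[p])] (n j : ℕ) :
    (mazurTateElementOdd f p n).coeff j =
      ∑ ξ : rootsOfUnity (torsionOrder p) ℤ_[p], ∑ s : ZMod (p ^ n),
        (torsionQuadChar p ((ξ : ℤ_[p]ˣ) : ℤ_[p]) : ℚ) * ratMinusSymbol f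
          (((PadicInt.toZModPow (n + cyclotomicExponent p) ((ξ : ℤ_[p]ˣ) : ℤ_[p]) *
                (cyclotomicGenerator p : ZMod (p ^ (n + cyclotomicExponent p))) ^ s.val).val : ℚ) /
            (p : ℚ) ^ (n + cyclotomicExponent p)) * (s.val.choose j : ℚ) := by
  rw [mazurTateElementOdd, finsum_eq_sum_of_fintype, finsetSum_coeff]
  refine Finset.sum_congr rfl fun ξ _ ↦ ?_
  rw [finsetSum_coeff]
  refine Finset.sum_congr rfl fun s _ ↦ ?_
  rw [coeff_C_mul, coeff_X_add_one_pow]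

end OddElement

/-! ### `p = 2`: the `Δ = {±1}` doubling and level `0` -/

section Two

variable {N : ℕ} [NeZero N] (f : CuspForm (Gamma0 N) 2)

omit [NeZero N] in
/-- The `2`-adic roots of unity of order dividing `2` are `±1`; private helper (as in
`Sprung2017.SharpFlatPAdicLFunctionTwoProofs`). [folklore] -/
private theorem coe_rootsOfUnity_two_eq_one_or_neg_one (ξ : rootsOfUnity 2 ℤ_[2]) :
    ((ξ : ℤ_[2]ˣ) : ℤ_[2]) = 1 ∨ ((ξ : ℤ_[2]ˣ) : ℤ_[2]) = -1 := by
  have h := ξ.2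
  rw [mem_rootsOfUnity] at h
  have h' : (((ξ : ℤ_[2]ˣ) : ℤ_[2])) ^ 2 = 1 := by
    rw [← Units.val_pow_eq_pow_val, h, Units.val_one]
  exact sq_eq_one_iff.mp h'

/-- **`[(−x)/2ʲ]⁻_f = −[x/2ʲ]⁻_f` for `x ∈ ℤ/2ʲ`** (representatives in `[0, 2ʲ)`): `(−x).val = 2ʲ − x.val`
(`x ≠ 0`), periodicity `[r + 1]⁻ = [r]⁻` (`ratMinusSymbol_add_intCast`) and oddness `[−r]⁻ = −[r]⁻`
(`ratMinusSymbol_neg`); at `x = 0`, `[0]⁻ = 0`. Twin of `ratPlusSymbol_neg_val_div`.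
[cite: MazurTateTeitelbaum1986Invent, §I.8 ([−r]⁻ = −[r]⁻) and §I.4 (4.2)] -/
theorem ratMinusSymbol_neg_val_div (j : ℕ) (x : ZMod (2 ^ j)) :
    ratMinusSymbol f ((((-x).val : ℕ) : ℚ) / ((2 : ℕ) : ℚ) ^ j) =
      -ratMinusSymbol f (((x.val : ℕ) : ℚ) / ((2 : ℕ) : ℚ) ^ j) := by
  by_cases hx : x = 0
  · subst hx
    rw [neg_zero, ZMod.val_zero, Nat.cast_zero, zero_div, ratMinusSymbol_zero, neg_zero]
  haveI : NeZero (2 ^ j) := ⟨pow_ne_zero _ two_ne_zero⟩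
  have hval : (-x).val = 2 ^ j - x.val := by rw [ZMod.neg_val, if_neg hx]
  have hlt : x.val ≤ 2 ^ j := (ZMod.val_lt x).le
  have hcast : (((-x).val : ℕ) : ℚ) = (2 : ℚ) ^ j - (x.val : ℚ) := by
    rw [hval, Nat.cast_sub hlt]; push_cast; ring
  have e : (((-x).val : ℕ) : ℚ) / ((2 : ℕ) : ℚ) ^ j =
      -((((x.val : ℕ) : ℚ)) / ((2 : ℕ) : ℚ) ^ j) + ((1 : ℤ) : ℚ) := by
    rw [hcast]; push_cast; field_simp; ring
  rw [e, ratMinusSymbol_add_intCast, ratMinusSymbol_neg]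

/-- **The `Δ`-doubling of `θ⁻_n` at `p = 2`**: `θ⁻_n(T) = Σ_{s mod 2ⁿ} 2·[5^s/2^{n+2}]⁻_f (1+T)^s` —
`Δ = {±1}`, `ω(−1)·[−5^s/2^{n+2}]⁻ = (−1)·(−[5^s/2^{n+2}]⁻) = [5^s/2^{n+2}]⁻`
(`ratMinusSymbol_neg_val_div`). Twin of `Sprung2017.mazurTateElement_two_eq`.
[cite: MazurTateTeitelbaum1986Invent, §I.13 (p = 2: Δ = {±1}, γ = 5) and §I.8] -/
theorem mazurTateElementOdd_two_eq (n : ℕ) :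
    mazurTateElementOdd f 2 n = ∑ s : ZMod (2 ^ n),
      C (2 * ratMinusSymbol f
        ((((cyclotomicGenerator 2 : ZMod (2 ^ (n + 2))) ^ s.val).val : ℚ) / (2 : ℚ) ^ (n + 2))) *
        (X + 1) ^ s.val := by
  classical
  -- the summand as a function of the Teichmüller representative
  set G : ℤ_[2] → ℚ[X] := fun u ↦ ∑ s : ZMod (2 ^ n),
    C ((torsionQuadChar 2 u : ℚ) * ratMinusSymbol f
      (((PadicInt.toZModPow (n + 2) u *
          (cyclotomicGenerator 2 : ZMod (2 ^ (n + 2))) ^ s.val).val : ℚ) / (2 : ℚ) ^ (n + 2))) *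
      (X + 1) ^ s.val with hG
  have hG1 : G 1 = ∑ s : ZMod (2 ^ n),
      C (ratMinusSymbol f
        ((((cyclotomicGenerator 2 : ZMod (2 ^ (n + 2))) ^ s.val).val : ℚ) / (2 : ℚ) ^ (n + 2))) *
        (X + 1) ^ s.val := by
    simp only [hG, map_one, one_mul, torsionQuadChar_one, Int.cast_one]
  have hGneg : G (-1) = G 1 := by
    rw [hG1]
    simp only [hG, map_neg, map_one, neg_one_mul, torsionQuadChar_two_neg_one, Int.cast_neg,
      Int.cast_one]
    refine Finset.sum_congr rfl fun s _ ↦ ?_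
    have h := ratMinusSymbol_neg_val_div f (n + 2)
      ((cyclotomicGenerator 2 : ZMod (2 ^ (n + 2))) ^ s.val)
    push_cast at h ⊢
    simp only [h, map_neg, neg_neg]
  -- the torsion group at `2` is `{1, ζ}` with `ζ = -1`
  have hζmem : (-1 : ℤ_[2]ˣ) ∈ rootsOfUnity 2 ℤ_[2] := by
    rw [mem_rootsOfUnity]; norm_num
  set ζ : rootsOfUnity 2 ℤ_[2] := ⟨-1, hζmem⟩ with hζ
  have hne : (1 : rootsOfUnity 2 ℤ_[2]) ≠ ζ := by
    intro h
    have h' : (((1 : rootsOfUnity 2 ℤ_[2]) : ℤ_[2]ˣ) : ℤ_[2]) = ((ζ : ℤ_[2]ˣ) : ℤ_[2]) := by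
      rw [h]
    rw [hζ] at h'
    simp only [OneMemClass.coe_one, Units.val_one, Units.val_neg] at h'
    have h2 : (2 : ℤ_[2]) = 0 := by linear_combination h'
    exact two_ne_zero h2
  haveI : Fintype (rootsOfUnity 2 ℤ_[2]) := Fintype.ofFinite _
  have huniv : (Finset.univ : Finset (rootsOfUnity 2 ℤ_[2])) = {1, ζ} := by
    ext ξ
    simp only [Finset.mem_univ, Finset.mem_insert, Finset.mem_singleton, true_iff]
    rcases coe_rootsOfUnity_two_eq_one_or_neg_one ξ with h | h
    · left
      exact Subtype.ext (Units.ext (by simpa using h))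
    · right
      exact Subtype.ext (Units.ext (by rw [hζ]; simpa using h))
  -- unfold the element at `p = 2` (`cyclotomicExponent 2 = 2` by computation)
  have hθ : mazurTateElementOdd f 2 n =
      ∑ᶠ ξ : rootsOfUnity (torsionOrder 2) ℤ_[2], G ((ξ : ℤ_[2]ˣ) : ℤ_[2]) := by
    rw [mazurTateElementOdd]
    rfl
  rw [hθ, torsionOrder_two, finsum_eq_sum_of_fintype, huniv, Finset.sum_pair hne]
  simp only [OneMemClass.coe_one, Units.val_one, hζ, Units.val_neg]
  rw [hGneg, hG1, ← Finset.sum_add_distrib]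
  refine Finset.sum_congr rfl fun s _ ↦ ?_
  rw [← add_mul, ← map_add, ← two_mul]

/-- **Level `0` at `p = 2`: `θ⁻_0 = 2·[1/4]⁻_f`** (a constant: `Γ_0` is trivial, the level is `4`,
`5⁰ = 1`). [cite: MazurTateTeitelbaum1986Invent, §I.13 (p = 2)] -/
theorem mazurTateElementOdd_two_zero :
    mazurTateElementOdd f 2 0 = C (2 * ratMinusSymbol f (1 / 4)) := by
  rw [mazurTateElementOdd_two_eq]
  haveI : Subsingleton (ZMod (2 ^ 0)) := ZMod.subsingleton_iff.2 (by norm_num)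
  rw [Finset.sum_eq_single_of_mem (0 : ZMod (2 ^ 0)) (Finset.mem_univ _)
    (fun s _ hs ↦ absurd (Subsingleton.elim s 0) hs)]
  rw [ZMod.val_zero, pow_zero, pow_zero, mul_one, ZMod.val_one_eq_one_mod]
  norm_num

/-- **`θ⁻_0(0) = [1/4]⁻_f − [3/4]⁻_f` at `p = 2`** (`2·[1/4]⁻ = [1/4]⁻ − [3/4]⁻` by
`[3/4]⁻ = [−1/4 + 1]⁻ = −[1/4]⁻`): the minus twisted symbol sum of `χ₋₄`, i.e. the quantity
`α²·L⁻₂(f, α, ω, 0)` of `constantCoeff_padicLFunctionMinusBranch_one_two` and (Birch's lemma,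
`ratMinusTwistedSymbolSum_mul_minusPeriod_mul_I`) `2·L(f, χ₋₄, 1)/Ω⁻_f` up to the tree's `Ω⁻_f`
normalisation — that identification is not made here. [cite: MazurTateTeitelbaum1986Invent, §I.8 (8.6) and §I.13] -/
theorem eval_zero_mazurTateElementOdd_two_zero :
    (mazurTateElementOdd f 2 0).eval 0 = ratMinusSymbol f (1 / 4) - ratMinusSymbol f (3 / 4) := by
  rw [mazurTateElementOdd_two_zero, eval_C]
  have h : ratMinusSymbol f (3 / 4) = -ratMinusSymbol f (1 / 4) := by
    rw [show (3 / 4 : ℚ) = -(1 / 4) + ((1 : ℤ) : ℚ) by norm_num, ratMinusSymbol_add_intCast,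
      ratMinusSymbol_neg]
  rw [h]; ring

end Two

end Literature.NumberTheory.EllipticCurves

/-! ### The ♯/♭ pair of the odd branch -/

namespace Literature.NumberTheory.EllipticCurves.Sprung2017

variable {N : ℕ} (f : CuspForm (Gamma0 N) 2) (p : ℕ) [Fact p.Prime]

/-- **`(L♯₋, L♭₋)` is a Sprung pair for the ODD (quadratic) branch of `f` at `p` (trace `a_p = ap`)**:
for every level `n ≥ 0`, `θ⁻_n ≡ −(u_n · L♯₋ + v_n · L♭₋) (mod ω_n)` in `Λ ⊗ ℚ_p`, with
`θ⁻_n = mazurTateElementOdd f p n`, the SAME polynomials `u_n = sharpPoly ap p n`, `v_n = flatPoly ap p n`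
as for the even branch (Sprung fixes a tame character `ω^i` and runs the same matrices
`𝒞_1 ⋯ 𝒞_n`: the three-term Hecke recursion is branch-independent), `ω_n = (1+T)^{pⁿ} − 1`, and
"`≡ (mod ω_n)` in `Λ ⊗ ℚ_p`" the tree's `IsCongrModOmega` (constant multiplier `−1`). Verbatim the
tree's `IsSprungPair` with `mazurTateElement ↦ mazurTateElementOdd`. At `p = 2` this is the pair of
the `ω = χ₋₄` branch. A predicate; nothing asserted (existence is NOT proved here).
[cite: Sprung2017, Thm. 1.12 and Cor. 4.4 ("Fix a tame character ω^i"; shape only, nothing asserted)] -/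
def IsSprungPairOdd (ap : ℤ) (Lsharp Lflat : IwasawaAlgebra p) : Prop :=
  ∀ n : ℕ, IsCongrModOmega p n (mazurTateElementOdd f p n) (-1)
    (toIwasawa p (sharpPoly ap p n) * Lsharp + toIwasawa p (flatPoly ap p n) * Lflat)

/-- Unfolding lemma for `IsSprungPairOdd`. [cite: Sprung2017, Cor. 4.4 (shape only; nothing asserted)] -/
theorem isSprungPairOdd_iff (ap : ℤ) (Lsharp Lflat : IwasawaAlgebra p) :
    IsSprungPairOdd f p ap Lsharp Lflat ↔
      ∀ n : ℕ, IsCongrModOmega p n (mazurTateElementOdd f p n) (-1)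
        (toIwasawa p (sharpPoly ap p n) * Lsharp + toIwasawa p (flatPoly ap p n) * Lflat) :=
  Iff.rfl

/-- The level-`n` clause of an odd Sprung pair. [cite: Sprung2017, Cor. 4.4 (shape only)] -/
theorem IsSprungPairOdd.congr {f : CuspForm (Gamma0 N) 2} {p : ℕ} [Fact p.Prime] {ap : ℤ}
    {Lsharp Lflat : IwasawaAlgebra p} (h : IsSprungPairOdd f p ap Lsharp Lflat) (n : ℕ) :
    IsCongrModOmega p n (mazurTateElementOdd f p n) (-1)
      (toIwasawa p (sharpPoly ap p n) * Lsharp + toIwasawa p (flatPoly ap p n) * Lflat) :=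
  h n

end Literature.NumberTheory.EllipticCurves.Sprung2017

end
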